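import Mathlib
import HarnessLib
import Literature.NumberTheory.GaloisRepresentations.WildInertia
import Literature.NumberTheory.GaloisRepresentations.AbsGaloisGroupCompact
import Literature.NumberTheory.GaloisRepresentations.AbsGaloisGroupOpenNormal
import Literature.NumberTheory.GaloisRepresentations.CyclotomicCharacterSurjectiveProofs

/-! # Stub `stub_wildInertiaSquare` (line `local_clause_cut`, crux `EmptyWeightCore`, stmt-Langlands-17008)

For a non-archimedean local field `K` with *odd* residue characteristic `p = ringChar 𝓀[K]` and
a uniformiser `ϖ`, every element `π` of the wild inertia group `P = absWildInertia K ϖ ≤ Γ_K` is a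
square *inside* `P`: `P` is 2-divisible.  Reason: `P` is a pro-`p` group
(`absWildInertia_isProP_holds`: for every open subgroup `N ≤ Γ_K` some `π ^ (p ^ a)` lies in `N`)
and `p ^ a` is odd, so `y_N = π ^ ((p ^ a + 1) / 2) ∈ P` satisfies `y_N² π⁻¹ = π ^ (p ^ a) ∈ N`;
the sets `S_N = {y ∈ P | y² π⁻¹ ∈ N}` are closed (`P` is closed, `N` is clopen), nonempty and
directed, so by compactness of `Γ_K` (`absoluteGaloisGroup_compactSpace`) they have a common point
`y`; then `y² π⁻¹` lies in every open subgroup, in particular in the (open) stabiliser of every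
`x ∈ K̄`, hence `y² π⁻¹ = 1` (the action of `Γ_K` on `K̄` is faithful).
-/

set_option linter.dupNamespace false

noncomputable section

namespace Summit.Langlands.Langlands.Cruxes.EmptyWeightCore.LocalClauseCut

open Literature.NumberTheory.GaloisRepresentations Field ValuativeRel

/-- The wild inertia group `P_K = absWildInertia K ϖ` is closed in `Γ_K`: it is the intersection of
the closed inertia group (`isClosed_absInertia_holds`) with the closed sets
`{σ | σ • z = z}` (`RootOfUnityAction.isClosed_setOf_smul_eq`), `z` a prime-to-`p`-th root of `ϖ`.
Ref: Serre, Invent. Math. 15 (1972), §1.3. [folklore] -/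
private theorem isClosed_absWildInertia {K : Type} [Field K] [ValuativeRel K] [TopologicalSpace K]
    [IsNonarchimedeanLocalField K] (ϖ : 𝒪[K]) :
    IsClosed (absWildInertia K ϖ : Set (absoluteGaloisGroup K)) := by
  have hI : IsClosed (absInertia K : Set (absoluteGaloisGroup K)) := isClosed_absInertia_holds K
  have hset : (absWildInertia K ϖ : Set (absoluteGaloisGroup K)) =
      (absInertia K : Set (absoluteGaloisGroup K)) ∩
        ⋂ (d : ℕ) (_ : 0 < d) (_ : ¬ ringChar 𝓀[K] ∣ d) (z : AlgebraicClosure K)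
          (_ : z ^ d = algebraMap 𝒪[K] (AlgebraicClosure K) ϖ),
          {σ : absoluteGaloisGroup K | σ • z = z} := by
    ext σ
    simp only [SetLike.mem_coe, mem_absWildInertia_iff, Set.mem_inter_iff, Set.mem_iInter,
      Set.mem_setOf_eq]
  rw [hset]
  exact hI.inter (isClosed_iInter fun d => isClosed_iInter fun _ => isClosed_iInter fun _ =>
    isClosed_iInter fun z => isClosed_iInter fun _ => RootOfUnityAction.isClosed_setOf_smul_eq z z)

/-- **The wild inertia group is 2-divisible (odd residue characteristic).**  For a uniformiser `ϖ`
of a non-archimedean local field `K` with `p = ringChar 𝓀[K] ≠ 2`, every `π ∈ P = absWildInertia K ϖ`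
is `y * y` for some `y ∈ P`.  Proof: `P` is pro-`p` (`absWildInertia_isProP_holds`), so for each
open subgroup `N ≤ Γ_K` some `π ^ (p ^ a) ∈ N` with `p ^ a = 2 m + 1` odd, and `y = π ^ (m + 1) ∈ P`
has `y² π⁻¹ = π ^ (p ^ a) ∈ N`; the closed nonempty directed family
`S_N = {y ∈ P | y² π⁻¹ ∈ N}` in the compact group `Γ_K` (`absoluteGaloisGroup_compactSpace`,
`isClosed_absWildInertia`, `OpenSubgroup.isClosed`) has a common point `y`
(`IsCompact.nonempty_iInter_of_directed_nonempty_isCompact_isClosed`), and `y² π⁻¹ = 1` because it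
lies in the open stabiliser (`stabilizer_isOpen_of_isIntegral`) of every `x ∈ K̄` and `Γ_K` acts
faithfully on `K̄`.
Ref: Serre, *Local Fields*, Ch. IV §2, Cor. 3 of Prop. 7 and Exercises 1–2 (`G_1` is a pro-`p`
group); a pro-`p` group with `p` odd is uniquely 2-divisible.
[cite: SerreLocalFields1979, Ch. IV §2, Cor. 3 of Prop. 7 and Exercises 1–2] -/
theorem stub_wildInertiaSquare :
    ∀ (K : Type) [Field K] [ValuativeRel K] [TopologicalSpace K] [IsNonarchimedeanLocalField K]
      (ϖ : 𝒪[K]), Irreducible ϖ → ringChar 𝓀[K] ≠ 2 →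
      ∀ π ∈ absWildInertia K ϖ, ∃ y ∈ absWildInertia K ϖ, y * y = π := by
  intro K _ _ _ _ ϖ hϖ hp2 π hπ
  classical
  haveI : CompactSpace (absoluteGaloisGroup K) := absoluteGaloisGroup_compactSpace K
  have hpodd : Odd (ringChar 𝓀[K]) := (ringChar_residueField_prime (F := K)).odd_of_ne_two hp2
  -- the family `S N = {y ∈ P | y² π⁻¹ ∈ N}`, `N` an open subgroup of `Γ_K`
  obtain ⟨S, hS⟩ : ∃ S : OpenSubgroup (absoluteGaloisGroup K) → Set (absoluteGaloisGroup K),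
      ∀ N y, y ∈ S N ↔ y ∈ absWildInertia K ϖ ∧ y * y * π⁻¹ ∈ N :=
    ⟨fun N => {y | y ∈ absWildInertia K ϖ ∧ y * y * π⁻¹ ∈ N}, fun _ _ => Iff.rfl⟩
  have hSdir : Directed (· ⊇ ·) S := by
    intro N₁ N₂
    refine ⟨N₁ ⊓ N₂, fun y hy => ?_, fun y hy => ?_⟩
    · obtain ⟨hyP, hyN⟩ := (hS _ y).mp hy
      exact (hS N₁ y).mpr ⟨hyP, (OpenSubgroup.mem_inf.mp hyN).1⟩
    · obtain ⟨hyP, hyN⟩ := (hS _ y).mp hy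
      exact (hS N₂ y).mpr ⟨hyP, (OpenSubgroup.mem_inf.mp hyN).2⟩
  have hSne : ∀ N, (S N).Nonempty := by
    intro N
    obtain ⟨a, ha⟩ := absWildInertia_isProP_holds (F := K) hϖ hπ
      (N : Subgroup (absoluteGaloisGroup K)) N.isOpen
    obtain ⟨m, hm⟩ : Odd (ringChar 𝓀[K] ^ a) := hpodd.pow
    have hexp : m + 1 + (m + 1) = ringChar 𝓀[K] ^ a + 1 := by omega
    have key : π ^ (m + 1) * π ^ (m + 1) * π⁻¹ = π ^ (ringChar 𝓀[K] ^ a) := by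
      rw [← pow_add, hexp, pow_succ, mul_inv_cancel_right]
    refine ⟨π ^ (m + 1), (hS N _).mpr ⟨Subgroup.pow_mem _ hπ _, ?_⟩⟩
    rw [key]
    exact ha
  have hSclosed : ∀ N, IsClosed (S N) := by
    intro N
    have hset : S N = (absWildInertia K ϖ : Set (absoluteGaloisGroup K)) ∩
        (fun y : absoluteGaloisGroup K => y * y * π⁻¹) ⁻¹' (N : Set (absoluteGaloisGroup K)) :=
      Set.ext fun y => hS N y
    rw [hset]
    exact (isClosed_absWildInertia ϖ).inter ((OpenSubgroup.isClosed N).preimage (by fun_prop))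
  have hScomp : ∀ N, IsCompact (S N) := fun N => (hSclosed N).isCompact
  obtain ⟨y, hy⟩ :=
    IsCompact.nonempty_iInter_of_directed_nonempty_isCompact_isClosed S hSdir hSne hScomp hSclosed
  rw [Set.mem_iInter] at hy
  refine ⟨y, ((hS ⊤ y).mp (hy ⊤)).1, ?_⟩
  -- `y² π⁻¹` lies in every open subgroup of `Γ_K`, hence fixes every `x ∈ K̄`, hence is `1`
  have h1 : y * y * π⁻¹ = 1 := by
    refine FaithfulSMul.eq_of_smul_eq_smul (α := AlgebraicClosure K) fun x => ?_
    rw [one_smul]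
    have hx : y * y * π⁻¹ ∈ MulAction.stabilizer (absoluteGaloisGroup K) x :=
      ((hS ⟨MulAction.stabilizer (absoluteGaloisGroup K) x,
        stabilizer_isOpen_of_isIntegral (K := K) (L := AlgebraicClosure K) x⟩ y).mp (hy _)).2
    exact MulAction.mem_stabilizer_iff.mp hx
  exact mul_inv_eq_one.mp h1

end Summit.Langlands.Langlands.Cruxes.EmptyWeightCore.LocalClauseCut

end
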